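import Summits.Ventures.HodgeRepro2.T5RecordSphericalSpectrumSevenToy
import Summits.Ventures.HodgeRepro2.T5CyclotomicSevenDegreeOnePrime
import Summits.Ventures.HodgeRepro2.T5CyclotomicSevenHeckeCommutative

/-!
# The unramified spectrum of the record's pair on `ℚ(ζ₇)` at EVERY degree-one inert place: `q = p`

Tier-5 support N3 / §G-N4.2 (seat p3, gen 86). Files 347 / 350 read file 344's unramified-spectrum theorem on the
field of record `ℚ(ζ₇)` at the inert places of order `6` (`p ≡ 3, 5 (mod 7)`, `q = p³`). The remaining inert primes are
those of order `2` modulo `7` (`p ≡ 6 (mod 7)`: `13, 41, 83, 97, …`): every place `v` of `ℚ(ζ₇)⁺` above such a `p`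
has `N(v) = p` and stays prime in `ℚ(ζ₇)` (file `T5CyclotomicSevenDegreeOnePrime`: `exists_liesOver_and_map_eq`,
`absNorm_eq`). The place `w` above `v` is given there existentially, so the statement is an existential over `w`
and the hypothesis `hmap : v 𝓞_K = w` that file 344's conclusion carries:

* **`exists_mulEquiv_forall_nonempty_equiv_inertSphericalQuot_record_seven_degree_one`** — for any seventh
  cyclotomic extension `K`, any prime `p` of order `2` mod `7`, any place `v` of `K⁺` above `p`, any datum and any
  generators: there is `w ∣ v` with `v 𝓞_K = w` such that `u₀`, `Φ : U(J₃(u₀)) ≃* U(1 ⊗ H₀)` matching the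
  hyperspecial subgroups and a star-fixed uniformiser `ϖ'` exist with every irreducible `K_v`-finite representation
  of `U(1 ⊗ H₀)` with non-zero finite-dimensional `K_v`-invariants `≅ (inertSphericalQuot (α · (p²)⁻¹)) ∘ Φ⁻¹` for
  some `α ≠ 0`;
* **`…_record_seven_thirteen`** — at `p = 13` (`q = 13`, Satake parameter `α / 169`; the order of `13` from the place
  file's `orderOf_thirteen_zmod_seven`).

Together with files 347 / 350 the principal-series identification of rows 12–14 is kernel at EVERY inert place of
the field of record (orders `6` and `2`), with the Satake parameter in the normalisation `α · q⁻²`.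

§8(d): uses an L-value-free non-vanishing device: NO.
-/

open Matrix NumberField NumberField.IsCMField IsDedekindDomain IsDedekindDomain.HeightOneSpectrum Module
  MulAction
open scoped TensorProduct Pointwise
open Summit.Ventures.HodgeRepro2.T5UnitaryGroupForm Summit.Ventures.HodgeRepro2.T5UnitaryHeckeAdjoint
  Summit.Ventures.HodgeRepro2.T5HeckePermutationModule Summit.Ventures.HodgeRepro2.LevelPositivity
  Summit.Ventures.HodgeRepro2.T5LevelIdempotent Summit.Ventures.HodgeRepro2.T5StarOfInvolution
  Summit.Ventures.HodgeRepro2.T5FinitePlaceCM Summit.Ventures.HodgeRepro2.T5NonSplitPlaceUnitaryGroup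
  Summit.Ventures.HodgeRepro2.T5RecordHyperspecial Summit.Ventures.HodgeRepro2.T5GlobalLatticeAlmostAll
  Summit.Ventures.HodgeRepro2.T5HermitianThreeElements Summit.Ventures.HodgeRepro2.T5GaloisCartanThree
  Summit.Ventures.HodgeRepro2.T5InertDegreeGalois Summit.Ventures.HodgeRepro2.T5InertPlaceCompletion
  Summit.Ventures.HodgeRepro2.T5InertDegreeAdicCompletion Summit.Ventures.HodgeRepro2.T5InertSatakeTransform
  Summit.Ventures.HodgeRepro2.T5InertSatakeTransformCompletion Summit.Ventures.HodgeRepro2.T5InertUnipotentResidue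
  Summit.Ventures.HodgeRepro2.T5InertSphericalSubquotient Summit.Ventures.HodgeRepro2.T5RecordSatakeCell
  Summit.Ventures.HodgeRepro2.T5SplitPlaceUnitaryGroup Summit.Ventures.HodgeRepro2.T5FinitePlaceNormIndex
  Summit.Ventures.HodgeRepro2.T5HermitianLocalIsotropyN3 Summit.Ventures.HodgeRepro2.T5FinitePlaceSplitClassification
  Summit.Ventures.HodgeRepro2.T5InertDegreeCompletion Summit.Ventures.HodgeRepro2.T5InertPlaceCompletionCells
  Summit.Ventures.HodgeRepro2.T5RecordSatake Summit.Ventures.HodgeRepro2.T5CartanCellsDistinct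
  Summit.Ventures.HodgeRepro2.T5RecordSatakeInert Summit.Ventures.HodgeRepro2.T5InertGlobalPrime
  Summit.Ventures.HodgeRepro2.T5CMFieldSquareDatum Summit.Ventures.HodgeRepro2.T5RecordSatakeDegree
  Summit.Ventures.HodgeRepro2.T5RecordSatakeDegreeIntrinsic Summit.Ventures.HodgeRepro2.T5RecordSphericalSpectrum
  Summit.Ventures.HodgeRepro2.T5RecordSphericalSpectrumIntrinsic Summit.Ventures.HodgeRepro2.T5RecordSatakeToy
  Summit.Ventures.HodgeRepro2.T5CyclotomicSevenInertThree Summit.Ventures.HodgeRepro2.T5CyclotomicSevenNonDyadic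
  Summit.Ventures.HodgeRepro2.CyclotomicSeven Summit.Ventures.HodgeRepro2.T5CyclotomicSevenDegreeOnePrime
  Summit.Ventures.HodgeRepro2.T5CyclotomicSevenHeckeCommutative

namespace Summit.Ventures.HodgeRepro2.T5RecordSphericalSpectrumSevenDegreeOne

universe uV

section Generic

variable (K : Type*) [Field K] [CharZero K] [IsCyclotomicExtension {7} ℚ K] [NumberField K] [IsCMField K]
variable {θ : maximalRealSubfield K} {y : K}
  (hθ : algebraMap (maximalRealSubfield K) K θ = y ^ 2) (hy : complexConj K y ≠ y)
variable {r : ℕ} (l : Fin r → 𝓞 K) (k : Type*) [Field k] [CharZero k] [IsAlgClosed k]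

omit [IsCMField K] [CharZero k] [IsAlgClosed k] in
/-- `N(v) = p` in any field `k`, for `v` above a prime `p` of order `2` modulo `7`. -/
theorem absNorm_cast (p : ℕ) [Fact p.Prime] (h2 : orderOf (p : ZMod 7) = 2)
    (v : HeightOneSpectrum (𝓞 (maximalRealSubfield K))) [v.asIdeal.LiesOver (Ideal.span {(p : ℤ)})] :
    (Ideal.absNorm v.asIdeal : k) = (p : k) := by
  rw [absNorm_eq K p h2 v]

include hθ hy in
/-- **THE UNRAMIFIED SPECTRUM OF THE RECORD'S PAIR ON `ℚ(ζ₇)` AT EVERY DEGREE-ONE INERT PLACE, `q = p`** (file 344's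
`exists_mulEquiv_forall_nonempty_equiv_inertSphericalQuot_record_of_staysPrime` at a place `v` above a prime `p`
with `orderOf (p : ZMod 7) = 2`, the place `w` and `hmap : v 𝓞_K = w` from `exists_liesOver_and_map_eq`,
`H := H₀ = diag(1, 1, −1)`, `q' = p`). -/
theorem exists_mulEquiv_forall_nonempty_equiv_inertSphericalQuot_record_seven_degree_one
    (p : ℕ) [Fact p.Prime] (h2 : orderOf (p : ZMod 7) = 2)
    (v : HeightOneSpectrum (𝓞 (maximalRealSubfield K))) [v.asIdeal.LiesOver (Ideal.span {(p : ℤ)})]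
    (hl : Submodule.span (𝓞 (maximalRealSubfield K)) (Set.range l) = ⊤) :
    ∃ w : HeightOneSpectrum (𝓞 K),
      ∃ hmap : Ideal.map (algebraMap (𝓞 (maximalRealSubfield K)) (𝓞 K)) v.asIdeal = w.asIdeal,
      letI := liesOver_of_map_eq K v w hmap
      letI := tensorStarRing K v
      letI := starRingOfQuadratic (finrank_eq_two K v w hθ hy
          (not_isSquare_of_staysPrime K v w hθ hy (hmap)))
        (localConj v w hθ.symm (span_pair_eq_top K hy)
          (not_isSquare_of_staysPrime K v w hθ hy (hmap))
          (complexConj K))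
        (localConj_ne_one v w hθ.symm (span_pair_eq_top K hy)
          (not_isSquare_of_staysPrime K v w hθ hy (hmap))
          (complexConj K) (complexConj_apply_eq_neg K hθ hy))
      haveI := isDiscreteValuationRing_integralClosure_adicCompletion v w
      haveI := finite_residueField_integralClosure_adicCompletion v w
      haveI : IsFractionRing (integralClosure (v.adicCompletionIntegers (maximalRealSubfield K))
          (w.adicCompletion K)) (w.adicCompletion K) :=
        integralClosure.isFractionRing_of_finite_extension (v.adicCompletion (maximalRealSubfield K))
          (w.adicCompletion K)
      ∃ (u₀ : (v.adicCompletionIntegers (maximalRealSubfield K))ˣ)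
        (Φ : ↥(formUnitaryGroup (J3 (algebraMap (v.adicCompletionIntegers (maximalRealSubfield K))
          (w.adicCompletion K)
          (u₀ : v.adicCompletionIntegers (maximalRealSubfield K))))) ≃*
          ↥(formUnitaryGroup (tensorGram K v (gramToy K))))
        (ϖ' : integralClosure (v.adicCompletionIntegers (maximalRealSubfield K))
          (w.adicCompletion K))
        (hϖ' : Irreducible ϖ')
        (hs' : star (algebraMap (integralClosure (v.adicCompletionIntegers (maximalRealSubfield K))
          (w.adicCompletion K)) (w.adicCompletion K) ϖ') =
            algebraMap (integralClosure (v.adicCompletionIntegers (maximalRealSubfield K))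
              (w.adicCompletion K)) (w.adicCompletion K) ϖ'),
        (∀ g, g ∈ hyperspecialSubgroup
            (integralClosure (v.adicCompletionIntegers (maximalRealSubfield K))
              (w.adicCompletion K))
            (J3 (algebraMap (v.adicCompletionIntegers (maximalRealSubfield K))
              (w.adicCompletion K)
              (u₀ : v.adicCompletionIntegers (maximalRealSubfield K)))) ↔
            Φ g ∈ recordHyperspecial K v l (gramToy K)) ∧
        ∀ {V : Type uV} [AddCommGroup V] [Module k V]
          (ρ : Representation k (↥(formUnitaryGroup (tensorGram K v (gramToy K)))) V) [ρ.IsIrreducible],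
          KFinite ρ (recordHyperspecial K v l (gramToy K)) →
          ∀ [FiniteDimensional k (invariants ρ (recordHyperspecial K v l (gramToy K)))],
          invariants ρ (recordHyperspecial K v l (gramToy K)) ≠ ⊥ →
          ∃ α : k, α ≠ 0 ∧ Nonempty (ρ.Equiv (comp Φ.symm
            (inertSphericalQuot
              (hstar_of_star_eq (localConj v w hθ.symm (span_pair_eq_top K hy)
                (not_isSquare_of_staysPrime K v w hθ hy (hmap))
                (complexConj K))
                (fun x => by
                  rw [star_p8_eq_star K v w hθ hy
                    (not_isSquare_of_staysPrime K v w hθ hy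
                      (hmap))]
                  rfl))
              (algebraMap (v.adicCompletionIntegers (maximalRealSubfield K))
                (w.adicCompletion K)
                (u₀ : v.adicCompletionIntegers (maximalRealSubfield K)))
              (star_algebraMap_of_star_eq (localConj v w hθ.symm
                (span_pair_eq_top K hy)
                (not_isSquare_of_staysPrime K v w hθ hy (hmap))
                (complexConj K))
                (fun x => by
                  rw [star_p8_eq_star K v w hθ hy
                    (not_isSquare_of_staysPrime K v w hθ hy
                      (hmap))]
                  rfl)
                (u₀ : v.adicCompletionIntegers (maximalRealSubfield K)))
              (algebraMap_unit_ne_zero (F := v.adicCompletion (maximalRealSubfield K)) u₀)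
              (isInteger_algebraMap (u₀ : v.adicCompletionIntegers (maximalRealSubfield K)))
              (isInteger_algebraMap_unit_inv u₀) hϖ' hs' k (α * ((p : k) ^ 2)⁻¹)))) :=
  (exists_liesOver_and_map_eq K p h2 v).elim fun w hwm =>
    ⟨w, hwm.2, @exists_mulEquiv_forall_nonempty_equiv_inertSphericalQuot_record_of_staysPrime K _ _ _ v w
      (liesOver_of_map_eq K v w hwm.2) _ _ hθ hy hwm.2 _ l k _ _ _ (p : k) (absNorm_cast K k p h2 v) hl _
      gramToy_isHermitian isUnit_det_gramToy (notMem_badSet_gramToy _)⟩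

end Generic

section Thirteen

variable (K : Type*) [Field K] [CharZero K] [IsCyclotomicExtension {7} ℚ K] [NumberField K] [IsCMField K]
variable [Fact (Nat.Prime 13)]
variable {θ : maximalRealSubfield K} {y : K}
  (hθ : algebraMap (maximalRealSubfield K) K θ = y ^ 2) (hy : complexConj K y ≠ y)
variable {r : ℕ} (l : Fin r → 𝓞 K) (k : Type*) [Field k] [CharZero k] [IsAlgClosed k]

include hθ hy in
/-- **THE UNRAMIFIED SPECTRUM ON `ℚ(ζ₇)` AT EVERY PLACE ABOVE `13`, `q = 13`**: the Satake parameter reads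
`α · (13²)⁻¹ = α / 169` (`[Fact (Nat.Prime 13)]` a section instance, inhabited by `fact_prime_thirteen`). -/
theorem exists_mulEquiv_forall_nonempty_equiv_inertSphericalQuot_record_seven_thirteen
    (v : HeightOneSpectrum (𝓞 (maximalRealSubfield K))) [v.asIdeal.LiesOver (Ideal.span {(13 : ℤ)})]
    (hl : Submodule.span (𝓞 (maximalRealSubfield K)) (Set.range l) = ⊤) :
    ∃ w : HeightOneSpectrum (𝓞 K),
      ∃ hmap : Ideal.map (algebraMap (𝓞 (maximalRealSubfield K)) (𝓞 K)) v.asIdeal = w.asIdeal,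
      letI := liesOver_of_map_eq K v w hmap
      letI := tensorStarRing K v
      letI := starRingOfQuadratic (finrank_eq_two K v w hθ hy
          (not_isSquare_of_staysPrime K v w hθ hy (hmap)))
        (localConj v w hθ.symm (span_pair_eq_top K hy)
          (not_isSquare_of_staysPrime K v w hθ hy (hmap))
          (complexConj K))
        (localConj_ne_one v w hθ.symm (span_pair_eq_top K hy)
          (not_isSquare_of_staysPrime K v w hθ hy (hmap))
          (complexConj K) (complexConj_apply_eq_neg K hθ hy))
      haveI := isDiscreteValuationRing_integralClosure_adicCompletion v w
      haveI := finite_residueField_integralClosure_adicCompletion v w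
      haveI : IsFractionRing (integralClosure (v.adicCompletionIntegers (maximalRealSubfield K))
          (w.adicCompletion K)) (w.adicCompletion K) :=
        integralClosure.isFractionRing_of_finite_extension (v.adicCompletion (maximalRealSubfield K))
          (w.adicCompletion K)
      ∃ (u₀ : (v.adicCompletionIntegers (maximalRealSubfield K))ˣ)
        (Φ : ↥(formUnitaryGroup (J3 (algebraMap (v.adicCompletionIntegers (maximalRealSubfield K))
          (w.adicCompletion K)
          (u₀ : v.adicCompletionIntegers (maximalRealSubfield K))))) ≃*
          ↥(formUnitaryGroup (tensorGram K v (gramToy K))))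
        (ϖ' : integralClosure (v.adicCompletionIntegers (maximalRealSubfield K))
          (w.adicCompletion K))
        (hϖ' : Irreducible ϖ')
        (hs' : star (algebraMap (integralClosure (v.adicCompletionIntegers (maximalRealSubfield K))
          (w.adicCompletion K)) (w.adicCompletion K) ϖ') =
            algebraMap (integralClosure (v.adicCompletionIntegers (maximalRealSubfield K))
              (w.adicCompletion K)) (w.adicCompletion K) ϖ'),
        (∀ g, g ∈ hyperspecialSubgroup
            (integralClosure (v.adicCompletionIntegers (maximalRealSubfield K))
              (w.adicCompletion K))
            (J3 (algebraMap (v.adicCompletionIntegers (maximalRealSubfield K))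
              (w.adicCompletion K)
              (u₀ : v.adicCompletionIntegers (maximalRealSubfield K)))) ↔
            Φ g ∈ recordHyperspecial K v l (gramToy K)) ∧
        ∀ {V : Type uV} [AddCommGroup V] [Module k V]
          (ρ : Representation k (↥(formUnitaryGroup (tensorGram K v (gramToy K)))) V) [ρ.IsIrreducible],
          KFinite ρ (recordHyperspecial K v l (gramToy K)) →
          ∀ [FiniteDimensional k (invariants ρ (recordHyperspecial K v l (gramToy K)))],
          invariants ρ (recordHyperspecial K v l (gramToy K)) ≠ ⊥ →
          ∃ α : k, α ≠ 0 ∧ Nonempty (ρ.Equiv (comp Φ.symm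
            (inertSphericalQuot
              (hstar_of_star_eq (localConj v w hθ.symm (span_pair_eq_top K hy)
                (not_isSquare_of_staysPrime K v w hθ hy (hmap))
                (complexConj K))
                (fun x => by
                  rw [star_p8_eq_star K v w hθ hy
                    (not_isSquare_of_staysPrime K v w hθ hy
                      (hmap))]
                  rfl))
              (algebraMap (v.adicCompletionIntegers (maximalRealSubfield K))
                (w.adicCompletion K)
                (u₀ : v.adicCompletionIntegers (maximalRealSubfield K)))
              (star_algebraMap_of_star_eq (localConj v w hθ.symm
                (span_pair_eq_top K hy)
                (not_isSquare_of_staysPrime K v w hθ hy (hmap))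
                (complexConj K))
                (fun x => by
                  rw [star_p8_eq_star K v w hθ hy
                    (not_isSquare_of_staysPrime K v w hθ hy
                      (hmap))]
                  rfl)
                (u₀ : v.adicCompletionIntegers (maximalRealSubfield K)))
              (algebraMap_unit_ne_zero (F := v.adicCompletion (maximalRealSubfield K)) u₀)
              (isInteger_algebraMap (u₀ : v.adicCompletionIntegers (maximalRealSubfield K)))
              (isInteger_algebraMap_unit_inv u₀) hϖ' hs' k (α * ((13 : k) ^ 2)⁻¹)))) :=
  exists_mulEquiv_forall_nonempty_equiv_inertSphericalQuot_record_seven_degree_one K hθ hy l k 13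
    orderOf_thirteen_zmod_seven v hl

end Thirteen

end Summit.Ventures.HodgeRepro2.T5RecordSphericalSpectrumSevenDegreeOne
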